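import Summits.QuantumFields.YangMills.Theorems.ColdStartUniversalityLatticeLangevinTimeDecorrelation
import Summits.QuantumFields.YangMills.Theorems.ColdStartUniversalityLatticeLangevinCocycleMain
import Summits.QuantumFields.YangMills.Theorems.ColdStartUniversalityLatticeLangevinWilsonReversibleMeasurable
import HarnessLib

/-!
# Route `ColdStartUniversality` (fixed-cut-off SZZ dynamics, sampler package): THE DISCRETE POISSON CORRECTOR OF THE `h`-SKELETON CHAIN —
# `u = Σ_(j≥0) κ_(jh) Ĝ`, `u − κ_h u = Ĝ`, and its conditional variance integrates to the DISCRETE GREEN–KUBO constant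

Helper file (seat `ym-line-csu-p1`, g35; `--supports stmt-QuantumFields-24809`).  For the SU(2) lattice Langevin (Shen–Zhu–Zhu) dynamics at any
coupling `β'`, a realising Markov kernel family `κ`, a bounded measurable observable `|G| ≤ 1` with `Ĝ = G − μ_(β')(G)` and a sampling step
`h > 0`, the every-start exponential mixing of THE kernels (`abs_transition_sub_wilson_le_exp`: `|κ_t Ĝ| ≤ C e^(−ct)`) makes the Neumann series
`u = Σ_(j≥0) κ_(jh) Ĝ` converge uniformly; ★★★ `exists_discreteCorrector` exports, with `b = C/(1 − e^(−ch))`: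
* `u` is measurable and `|u| ≤ b`;
* the DISCRETE POISSON EQUATION `∫ u dκ_h(y) = u(y) − Ĝ(y)` (Chapman–Kolmogorov `chapmanKolmogorov_szz`, dominated convergence);
* the conditional variance `v(y) = ∫ u² dκ_h(y) − (∫ u dκ_h(y))²` satisfies `0 ≤ v ≤ b²`;
* ★★ the DISCRETE GREEN–KUBO IDENTITY `∫ v dμ_(β') = ∫ Ĝ² dμ + 2 Σ_(j≥0) ∫ Ĝ · κ_((j+1)h) Ĝ dμ` (invariance of `μ_(β')` under `κ_h`,
  `integral_transitionKernel_integral_eq_wilson`; the right-hand side is the asymptotic variance `lim N⁻¹ Var_μ(Σ_(k<N) Ĝ(U_(kh)))`,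
  Kipnis–Varadhan / Meyn–Tweedie Thm 17.0.1 form `2⟨Ĝ,u⟩_μ − ⟨Ĝ,Ĝ⟩_μ`).
It is the input of the central limit theorem for discrete samples of the cold-start sampler (next files).  THEOREMS ONLY, no definition, no sorry;
[folklore] (Neumann-series solution of the Poisson equation of a uniformly ergodic chain, cf. [cite: GlynnOrmoneit2002, proof of Theorem 2]).
HONEST FRAMING: fixed cut-off; `C, c` depend on `L, β'`; `UniformColdStartMixing` (24809) is NOT restated; no crux, rung or summit statement is
proved; the Yang–Mills mass gap is NOT proved.
-/

set_option autoImplicit false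

noncomputable section

namespace Summit.QuantumFields.YangMills.Theorems.ColdStartUniversality

open MeasureTheory ProbabilityTheory Filter Topology Set
open scoped NNReal ENNReal BigOperators
open Literature Literature.Probability.Process Literature.MathematicalPhysics.QuantumFieldTheory
open Literature.MathematicalPhysics.QuantumLattice (fundamentalRep fundamentalLatticeRep continuous_fundamentalRep)

variable {L : ℕ} [NeZero L]

/-- ★★★ **The discrete Poisson corrector of the `h`-skeleton of the SZZ dynamics.**  There are `C, c > 0` (`L, β'` only) such that for every
realising kernel family `κ`, every measurable `|G| ≤ 1` and every `h > 0` there is a measurable `u` with `|u| ≤ b := C/(1 − e^(−ch))`,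
`∫ u dκ_h(y) = u y − (G y − μG)`, conditional variance `0 ≤ ∫ u² dκ_h(y) − (∫ u dκ_h(y))² ≤ b²`, and the discrete Green–Kubo identity
`∫ (∫ u² dκ_h − (∫ u dκ_h)²) dμ = ∫ Ĝ² dμ + 2 Σ'_j ∫ Ĝ·κ_((j+1)h)Ĝ dμ`. [folklore] -/
theorem exists_discreteCorrector (L : ℕ) [NeZero L] (β' : ℝ) :
    ∃ C c : ℝ, 0 < C ∧ 0 < c ∧
      ∀ (κ : ℝ≥0 → Kernel (GaugeConfig 3 L (Matrix.specialUnitaryGroup (Fin 2) ℂ))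
          (GaugeConfig 3 L (Matrix.specialUnitaryGroup (Fin 2) ℂ))) [∀ t, IsMarkovKernel (κ t)],
        (∀ (t : ℝ≥0) (x : GaugeConfig 3 L (Matrix.specialUnitaryGroup (Fin 2) ℂ))
          (Ω : Type) [MeasurableSpace Ω] (P : Measure Ω) [IsProbabilityMeasure P]
          (W : ℝ≥0 → Ω → (Edge 3 L × NoiseIdx 2 → ℝ)) (hW : IsFlatBrownian W P)
          (U : ℝ≥0 → Ω → GaugeConfig 3 L (Matrix.specialUnitaryGroup (Fin 2) ℂ)),
          (∀ ω, U 0 ω = x) →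
          (latticeLangevinDynamics (fundamentalLatticeRep 2) β').IsSolution (fundamentalRep (Fin 2))
            hW.natFiltration P W U →
          κ t x = P.map (U t)) →
        ∀ (G : GaugeConfig 3 L (Matrix.specialUnitaryGroup (Fin 2) ℂ) → ℝ), Measurable G → (∀ z, |G z| ≤ 1) →
        ∀ (h : ℝ≥0), 0 < h →
          ∃ u : GaugeConfig 3 L (Matrix.specialUnitaryGroup (Fin 2) ℂ) → ℝ, Measurable u ∧
            (∀ y, |u y| ≤ C / (1 - Real.exp (-c * h))) ∧
            (∀ y, ∫ z, u z ∂(κ h y) = u y - (G y - ∫ z, G z ∂(wilsonMeasure (d := 3) (L := L) (fundamentalRep (Fin 2)) β'))) ∧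
            (∀ y, 0 ≤ (∫ z, u z ^ 2 ∂(κ h y)) - (∫ z, u z ∂(κ h y)) ^ 2) ∧
            (∀ y, (∫ z, u z ^ 2 ∂(κ h y)) - (∫ z, u z ∂(κ h y)) ^ 2 ≤ (C / (1 - Real.exp (-c * h))) ^ 2) ∧
            ∫ y, ((∫ z, u z ^ 2 ∂(κ h y)) - (∫ z, u z ∂(κ h y)) ^ 2) ∂(wilsonMeasure (d := 3) (L := L) (fundamentalRep (Fin 2)) β') =
              (∫ y, (G y - ∫ z, G z ∂(wilsonMeasure (d := 3) (L := L) (fundamentalRep (Fin 2)) β')) ^ 2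
                ∂(wilsonMeasure (d := 3) (L := L) (fundamentalRep (Fin 2)) β')) +
              2 * ∑' j : ℕ, ∫ y, (G y - ∫ z, G z ∂(wilsonMeasure (d := 3) (L := L) (fundamentalRep (Fin 2)) β')) *
                (∫ z, (G z - ∫ z', G z' ∂(wilsonMeasure (d := 3) (L := L) (fundamentalRep (Fin 2)) β')) ∂(κ (((j + 1 : ℕ) : ℝ≥0) * h) y))
                ∂(wilsonMeasure (d := 3) (L := L) (fundamentalRep (Fin 2)) β') := by
  classical
  haveI := secondCountableTopology_su2
  haveI := borelSpace_config L
  obtain ⟨C, c, hC, hc, hmix⟩ := abs_transition_sub_wilson_le_exp L β'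
  refine ⟨C, c, hC, hc, fun κ _ hreal G hG hG1 h hh => ?_⟩
  set μ : Measure (GaugeConfig 3 L (Matrix.specialUnitaryGroup (Fin 2) ℂ)) :=
    wilsonMeasure (d := 3) (L := L) (fundamentalRep (Fin 2)) β' with hμ
  haveI : IsProbabilityMeasure μ :=
    isProbabilityMeasure_wilsonMeasure (d := 3) (L := L) (fundamentalRep (Fin 2)) (continuous_fundamentalRep (Fin 2)) β'
  set m : ℝ := ∫ z, G z ∂μ with hm
  have hm1 : |m| ≤ 1 := by
    have hh' := norm_integral_le_of_norm_le_const (μ := μ) (f := G) (C := 1)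
      (Eventually.of_forall fun z => by simpa [Real.norm_eq_abs] using hG1 z)
    simpa [Real.norm_eq_abs] using hh'
  -- `ρ = e^(−ch) ∈ (0,1)`, `b = C/(1−ρ)`
  set ρ : ℝ := Real.exp (-c * h) with hρ
  have hρ0 : 0 < ρ := Real.exp_pos _
  have hρ1 : ρ < 1 := Real.exp_lt_one_iff.2 (by have : (0 : ℝ) < h := hh; nlinarith)
  set b : ℝ := C / (1 - Real.exp (-c * h)) with hb
  have hb0 : 0 < b := div_pos hC (by linarith)
  /- ### 1. The centred observable and the kernel actions `a_j = κ_(jh) Ĝ` -/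
  set Gh : GaugeConfig 3 L (Matrix.specialUnitaryGroup (Fin 2) ℂ) → ℝ := fun z => G z - m with hGh
  have hGhm : Measurable Gh := hG.sub measurable_const
  have hGhb : ∀ z, |Gh z| ≤ 2 := fun z => (abs_sub _ _).trans (by linarith [hG1 z, hm1])
  set a : ℕ → GaugeConfig 3 L (Matrix.specialUnitaryGroup (Fin 2) ℂ) → ℝ := fun j y => ∫ z, Gh z ∂(κ ((j : ℝ≥0) * h) y) with ha
  have ham : ∀ j, Measurable (a j) := fun j => (hGhm.stronglyMeasurable.integral_kernel (κ := κ ((j : ℝ≥0) * h))).measurable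
  have hGi : ∀ (ν : Measure (GaugeConfig 3 L (Matrix.specialUnitaryGroup (Fin 2) ℂ))) [IsProbabilityMeasure ν], Integrable G ν := fun ν _ =>
    (integrable_const (1 : ℝ)).mono' hG.aestronglyMeasurable (Eventually.of_forall fun z => by simpa [Real.norm_eq_abs] using hG1 z)
  have ha_eq : ∀ j y, a j y = (∫ z, G z ∂(κ ((j : ℝ≥0) * h) y)) - m := fun j y => by
    simp only [ha, hGh]
    rw [integral_sub (hGi _) (integrable_const m), integral_const, smul_eq_mul, probReal_univ, one_mul]
  have hab : ∀ j y, |a j y| ≤ C * ρ ^ j := fun j y => by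
    rw [ha_eq, hρ, ← Real.exp_nat_mul]
    have h1 := hmix κ hreal G hG hG1 ((j : ℝ≥0) * h) y
    have h2 : -c * (((j : ℝ≥0) * h : ℝ≥0) : ℝ) = j * (-c * h) := by push_cast; ring
    rwa [h2] at h1
  obtain ⟨-, hκ0, -⟩ : True ∧ κ 0 = Kernel.id ∧ True := by
    refine ⟨trivial, ?_, trivial⟩
    exact transitionKernel_zero_eq_id (L := L) β' κ hreal
  have ha0 : ∀ y, a 0 y = Gh y := fun y => by
    simp only [ha, Nat.cast_zero, zero_mul, hκ0, Kernel.id_apply]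
    exact integral_dirac' _ _ hGhm.stronglyMeasurable
  -- Chapman–Kolmogorov: `∫ a_j dκ_h(y) = a_(j+1)(y)`
  have hai : ∀ j (ν : Measure (GaugeConfig 3 L (Matrix.specialUnitaryGroup (Fin 2) ℂ))) [IsProbabilityMeasure ν], Integrable (a j) ν :=
    fun j ν _ => (integrable_const (C * ρ ^ j)).mono' (ham j).aestronglyMeasurable
      (Eventually.of_forall fun z => by rw [Real.norm_eq_abs]; exact hab j z)
  have hCK : ∀ j y, ∫ z, a j z ∂(κ h y) = a (j + 1) y := fun j y => by
    have hck := chapmanKolmogorov_szz β' κ hreal h ((j : ℝ≥0) * h)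
    have heq : (((j + 1 : ℕ) : ℝ≥0) * h) = h + (j : ℝ≥0) * h := by push_cast; ring
    have hGhi : Integrable Gh ((κ ((j : ℝ≥0) * h) ∘ₖ κ h) y) := by
      haveI : IsProbabilityMeasure ((κ ((j : ℝ≥0) * h) ∘ₖ κ h) y) := by rw [← hck]; infer_instance
      exact (integrable_const (2 : ℝ)).mono' hGhm.aestronglyMeasurable (Eventually.of_forall fun z => by
        rw [Real.norm_eq_abs]; exact hGhb z)
    show ∫ z, a j z ∂(κ h y) = ∫ z, Gh z ∂(κ (((j + 1 : ℕ) : ℝ≥0) * h) y)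
    rw [heq, hck, Kernel.integral_comp hGhi]
  /- ### 2. The Neumann series `u = Σ' a_j` -/
  have hgeomH : HasSum (fun j : ℕ => C * ρ ^ j) (C * (1 - ρ)⁻¹) := (hasSum_geometric_of_lt_one hρ0.le hρ1).mul_left C
  have hbC : C * (1 - ρ)⁻¹ = b := by rw [hb, hρ, div_eq_mul_inv]
  have hsum : ∀ y, Summable fun j => a j y := fun y =>
    Summable.of_norm_bounded hgeomH.summable (fun j => by rw [Real.norm_eq_abs]; exact hab j y)
  set u : GaugeConfig 3 L (Matrix.specialUnitaryGroup (Fin 2) ℂ) → ℝ := fun y => ∑' j, a j y with hu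
  have hub : ∀ y, |u y| ≤ b := fun y => by
    have h1 := tsum_of_norm_bounded hgeomH (fun j => by rw [Real.norm_eq_abs]; exact hab j y)
    rw [Real.norm_eq_abs, hbC] at h1
    exact h1
  -- partial sums, their uniform bound, and measurability of `u`
  set Su : ℕ → GaugeConfig 3 L (Matrix.specialUnitaryGroup (Fin 2) ℂ) → ℝ := fun M y => ∑ j ∈ Finset.range M, a j y with hSu
  have hSum : ∀ M, Measurable (Su M) := fun M => Finset.measurable_sum _ fun j _ => ham j
  have hgeom : ∀ M, ∑ j ∈ Finset.range M, ρ ^ j ≤ 1 / (1 - ρ) := fun M => by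
    rw [le_div_iff₀ (by linarith), geom_sum_mul_neg]
    linarith [pow_nonneg hρ0.le M]
  have hSub : ∀ M y, |Su M y| ≤ b := fun M y => by
    calc |Su M y| ≤ ∑ j ∈ Finset.range M, |a j y| := Finset.abs_sum_le_sum_abs _ _
      _ ≤ ∑ j ∈ Finset.range M, C * ρ ^ j := Finset.sum_le_sum fun j _ => hab j y
      _ = C * ∑ j ∈ Finset.range M, ρ ^ j := by rw [Finset.mul_sum]
      _ ≤ C * (1 / (1 - ρ)) := mul_le_mul_of_nonneg_left (hgeom M) hC.le
      _ = b := by rw [hb, hρ]; ring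
  have hSu_tend : ∀ y, Tendsto (fun M => Su M y) atTop (𝓝 (u y)) := fun y => (hsum y).hasSum.tendsto_sum_nat
  have hum : Measurable u :=
    measurable_of_tendsto_metrizable hSum (tendsto_pi_nhds.2 hSu_tend)
  /- ### 3. The discrete Poisson equation `κ_h u = u − Ĝ` -/
  have hsum1 : ∀ y, Summable fun j => a (j + 1) y := fun y => (summable_nat_add_iff 1).2 (hsum y)
  have hκu : ∀ y, ∫ z, u z ∂(κ h y) = ∑' j, a (j + 1) y := by
    intro y
    -- dominated convergence along the partial sums
    have hlim : Tendsto (fun M => ∫ z, Su M z ∂(κ h y)) atTop (𝓝 (∫ z, u z ∂(κ h y))) :=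
      tendsto_integral_of_dominated_convergence (fun _ => b) (fun M => (hSum M).aestronglyMeasurable) (integrable_const b)
        (fun M => Eventually.of_forall fun z => by rw [Real.norm_eq_abs]; exact hSub M z)
        (Eventually.of_forall fun z => hSu_tend z)
    have hlim' : Tendsto (fun M => ∫ z, Su M z ∂(κ h y)) atTop (𝓝 (∑' j, a (j + 1) y)) := by
      have heqM : ∀ M, ∫ z, Su M z ∂(κ h y) = ∑ j ∈ Finset.range M, a (j + 1) y := fun M => by
        simp only [hSu]
        rw [integral_finsetSum _ fun j _ => hai j _]
        exact Finset.sum_congr rfl fun j _ => hCK j y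
      rw [show (fun M => ∫ z, Su M z ∂(κ h y)) = fun M => ∑ j ∈ Finset.range M, a (j + 1) y from funext heqM]
      exact (hsum1 y).hasSum.tendsto_sum_nat
    exact tendsto_nhds_unique hlim hlim'
  have hPois : ∀ y, ∫ z, u z ∂(κ h y) = u y - Gh y := fun y => by
    rw [hκu, ← ha0 y]
    have h1 : u y = a 0 y + ∑' j, a (j + 1) y := (hsum y).tsum_eq_zero_add
    linarith
  /- ### 4. The conditional variance `v = κ_h(u²) − (κ_h u)²` -/
  have hui : ∀ (ν : Measure (GaugeConfig 3 L (Matrix.specialUnitaryGroup (Fin 2) ℂ))) [IsProbabilityMeasure ν], Integrable u ν := fun ν _ =>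
    (integrable_const b).mono' hum.aestronglyMeasurable (Eventually.of_forall fun z => by rw [Real.norm_eq_abs]; exact hub z)
  have hu2b : ∀ z, u z ^ 2 ≤ b ^ 2 := fun z => by rw [← sq_abs]; exact pow_le_pow_left₀ (abs_nonneg _) (hub z) 2
  have hu2i : ∀ (ν : Measure (GaugeConfig 3 L (Matrix.specialUnitaryGroup (Fin 2) ℂ))) [IsProbabilityMeasure ν],
      Integrable (fun z => u z ^ 2) ν := fun ν _ =>
    (integrable_const (b ^ 2)).mono' (hum.pow_const 2).aestronglyMeasurable (Eventually.of_forall fun z => by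
      rw [Real.norm_eq_abs, abs_of_nonneg (sq_nonneg _)]; exact hu2b z)
  -- `∫ u² dν − (∫ u dν)² = ∫ (u − ∫u dν)² dν` on a probability measure
  have hvar_eq : ∀ (ν : Measure (GaugeConfig 3 L (Matrix.specialUnitaryGroup (Fin 2) ℂ))) [IsProbabilityMeasure ν],
      (∫ z, u z ^ 2 ∂ν) - (∫ z, u z ∂ν) ^ 2 = ∫ z, (u z - ∫ w, u w ∂ν) ^ 2 ∂ν := fun ν _ => by
    set cu : ℝ := ∫ w, u w ∂ν with hcu
    have hexp : ∀ z, (u z - cu) ^ 2 = u z ^ 2 - (2 * cu) * u z + cu ^ 2 := fun z => by ring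
    have i1 : Integrable (fun z => u z ^ 2 - (2 * cu) * u z) ν := (hu2i ν).sub ((hui ν).const_mul _)
    rw [integral_congr_ae (ae_of_all _ hexp), integral_add i1 (integrable_const _),
      integral_sub (hu2i ν) ((hui ν).const_mul _), integral_const_mul, integral_const, smul_eq_mul, probReal_univ, one_mul]
    ring
  have hv0 : ∀ y, 0 ≤ (∫ z, u z ^ 2 ∂(κ h y)) - (∫ z, u z ∂(κ h y)) ^ 2 := fun y => by
    rw [hvar_eq]; exact integral_nonneg fun z => sq_nonneg _
  have hvb : ∀ y, (∫ z, u z ^ 2 ∂(κ h y)) - (∫ z, u z ∂(κ h y)) ^ 2 ≤ b ^ 2 := fun y => by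
    have h1 : ∫ z, u z ^ 2 ∂(κ h y) ≤ b ^ 2 := by
      calc ∫ z, u z ^ 2 ∂(κ h y) ≤ ∫ z, b ^ 2 ∂(κ h y) := integral_mono (hu2i _) (integrable_const _) hu2b
        _ = b ^ 2 := by simp
    nlinarith [sq_nonneg (∫ z, u z ∂(κ h y))]
  /- ### 5. The discrete Green–Kubo identity -/
  -- `∫ κ_h(u²) dμ = ∫ u² dμ` (invariance) and `∫ (κ_h u)² dμ = ∫ (u − Ĝ)² dμ` (Poisson)
  have hinv2 : ∫ y, (∫ z, u z ^ 2 ∂(κ h y)) ∂μ = ∫ y, u y ^ 2 ∂μ :=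
    integral_transitionKernel_integral_eq_wilson (L := L) β' κ hreal h (hum.pow_const 2)
      ⟨b ^ 2, fun z => by rw [abs_of_nonneg (sq_nonneg _)]; exact hu2b z⟩
  have hκum : Measurable fun y => ∫ z, u z ∂(κ h y) := (hum.stronglyMeasurable.integral_kernel (κ := κ h)).measurable
  have hκu2m : Measurable fun y => ∫ z, u z ^ 2 ∂(κ h y) := ((hum.pow_const 2).stronglyMeasurable.integral_kernel (κ := κ h)).measurable
  have hGhi' : Integrable Gh μ := (integrable_const (2 : ℝ)).mono' hGhm.aestronglyMeasurable
    (Eventually.of_forall fun z => by rw [Real.norm_eq_abs]; exact hGhb z)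
  have hGh2i : Integrable (fun z => Gh z ^ 2) μ := (integrable_const (4 : ℝ)).mono' (hGhm.pow_const 2).aestronglyMeasurable
    (Eventually.of_forall fun z => by
      rw [Real.norm_eq_abs, abs_of_nonneg (sq_nonneg _)]
      have := hGhb z; rw [← sq_abs]; nlinarith [abs_nonneg (Gh z)])
  have huGi : Integrable (fun z => u z * Gh z) μ := (integrable_const (b * 2)).mono' (hum.mul hGhm).aestronglyMeasurable
    (Eventually.of_forall fun z => by rw [Real.norm_eq_abs, abs_mul]; exact mul_le_mul (hub z) (hGhb z) (abs_nonneg _) hb0.le)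
  have hlhs : ∫ y, ((∫ z, u z ^ 2 ∂(κ h y)) - (∫ z, u z ∂(κ h y)) ^ 2) ∂μ = 2 * ∫ y, u y * Gh y ∂μ - ∫ y, Gh y ^ 2 ∂μ := by
    have hpt : ∀ y, (∫ z, u z ^ 2 ∂(κ h y)) - (∫ z, u z ∂(κ h y)) ^ 2 =
        (∫ z, u z ^ 2 ∂(κ h y)) - (u y ^ 2 - 2 * (u y * Gh y) + Gh y ^ 2) := fun y => by rw [hPois]; ring
    have iκu2 : Integrable (fun y => ∫ z, u z ^ 2 ∂(κ h y)) μ := (integrable_const (b ^ 2)).mono' hκu2m.aestronglyMeasurable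
      (Eventually.of_forall fun y => by
        rw [Real.norm_eq_abs, abs_of_nonneg (integral_nonneg fun z => sq_nonneg _)]
        calc ∫ z, u z ^ 2 ∂(κ h y) ≤ ∫ z, b ^ 2 ∂(κ h y) := integral_mono (hu2i _) (integrable_const _) hu2b
          _ = b ^ 2 := by simp)
    have i3 : Integrable (fun y => u y ^ 2 - 2 * (u y * Gh y)) μ := (hu2i μ).sub (huGi.const_mul 2)
    have i2 : Integrable (fun y => u y ^ 2 - 2 * (u y * Gh y) + Gh y ^ 2) μ := i3.add hGh2i
    rw [integral_congr_ae (ae_of_all _ hpt), integral_sub iκu2 i2, hinv2, integral_add i3 hGh2i,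
      integral_sub (hu2i μ) (huGi.const_mul 2), integral_const_mul]
    ring
  -- `∫ u·Ĝ dμ = Σ' ∫ a_j·Ĝ dμ = ∫ Ĝ² dμ + Σ' ∫ Ĝ·a_(j+1) dμ`
  have hcj : ∀ j, |∫ y, Gh y * a j y ∂μ| ≤ 2 * (C * ρ ^ j) := fun j => by
    have hh' := norm_integral_le_of_norm_le_const (μ := μ) (f := fun y => Gh y * a j y) (C := 2 * (C * ρ ^ j))
      (Eventually.of_forall fun y => by
        rw [Real.norm_eq_abs, abs_mul]; exact mul_le_mul (hGhb y) (hab j y) (abs_nonneg _) (by norm_num))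
    simpa [Real.norm_eq_abs] using hh'
  have hsumI : Summable fun j => ∫ y, Gh y * a j y ∂μ :=
    Summable.of_norm_bounded (hgeomH.summable.mul_left 2) (fun j => by rw [Real.norm_eq_abs]; exact hcj j)
  have huG : ∫ y, u y * Gh y ∂μ = ∑' j, ∫ y, Gh y * a j y ∂μ := by
    have hlim : Tendsto (fun M => ∫ y, Gh y * Su M y ∂μ) atTop (𝓝 (∫ y, u y * Gh y ∂μ)) := by
      have h1 : (fun y => u y * Gh y) = fun y => Gh y * u y := funext fun y => mul_comm _ _
      rw [h1]
      exact tendsto_integral_of_dominated_convergence (fun _ => 2 * b) (fun M => (hGhm.mul (hSum M)).aestronglyMeasurable)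
        (integrable_const _) (fun M => Eventually.of_forall fun z => by
          rw [Real.norm_eq_abs, abs_mul]; exact mul_le_mul (hGhb z) (hSub M z) (abs_nonneg _) (by norm_num))
        (Eventually.of_forall fun z => (hSu_tend z).const_mul (Gh z))
    have hlim' : Tendsto (fun M => ∫ y, Gh y * Su M y ∂μ) atTop (𝓝 (∑' j, ∫ y, Gh y * a j y ∂μ)) := by
      have heqM : ∀ M, ∫ y, Gh y * Su M y ∂μ = ∑ j ∈ Finset.range M, ∫ y, Gh y * a j y ∂μ := fun M => by
        simp only [hSu, Finset.mul_sum]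
        rw [integral_finsetSum _ fun j _ => ?_]
        exact (integrable_const (2 * (C * ρ ^ j))).mono' (hGhm.mul (ham j)).aestronglyMeasurable
          (Eventually.of_forall fun y => by rw [Real.norm_eq_abs, abs_mul]; exact mul_le_mul (hGhb y) (hab j y) (abs_nonneg _) (by norm_num))
      rw [show (fun M => ∫ y, Gh y * Su M y ∂μ) = fun M => ∑ j ∈ Finset.range M, ∫ y, Gh y * a j y ∂μ from funext heqM]
      exact hsumI.hasSum.tendsto_sum_nat
    exact tendsto_nhds_unique hlim hlim'
  have huG' : ∫ y, u y * Gh y ∂μ = (∫ y, Gh y ^ 2 ∂μ) + ∑' j, ∫ y, Gh y * a (j + 1) y ∂μ := by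
    rw [huG, hsumI.tsum_eq_zero_add]
    congr 1
    exact integral_congr_ae (ae_of_all _ fun y => by
      show Gh y * a 0 y = Gh y ^ 2
      rw [ha0]; ring)
  refine ⟨u, hum, hub, fun y => by rw [hPois], hv0, hvb, ?_⟩
  rw [hlhs, huG']
  ring
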